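import Mathlib
import HarnessLib
import Literature.Computability.AlgebraicComplexity.BILPS19MinrankVarieties
import Literature.Computability.AlgebraicComplexity.TensorRestrictionRank

/-!
# OutsiderSandwich — restrictions onto a unit tensor: sandwich, row independence, kernel dichotomy
(decomp-mm lens 4 «minimal-counterexample / extremal reduction», gen 39, kernel K39-b; THESES-FREE,
DEFINITION-FREE, summit-independent linear algebra over `ℂ` — imports `Literature` only)

A restriction `⟨r⟩ ≤ t` of a 3-tensor `t` onto the unit tensor, `⟨r⟩ = (A, B, C) · t`, is the family
of **sandwich identities** `B · t(A i) · Cᵀ = E_{ii}` (`sandwich_eq`, `t(x) = contract3 t x` the slice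
at the covector `x`), and all three factors have linearly independent rows (`linearIndependent_fst`,
`linearIndependent_snd`, `linearIndependent_trd`); the slices `E_{ii}` of `⟨r⟩` have rank `≤ 1`
(`rank_of_unitTensor_le`).

**Kernel dichotomy** (`ker_le_range_or`): if `B, C` (`r` independent rows each on `n`) and a symmetric
`M` satisfy `(B M Cᵀ) j l = 0` off the entry `(i, i)` and `rank M ≥ 2 (|n| - r)`, then
`ker B ⊆ col M` or `ker C ⊆ col M` — the rows `j ≠ i` of `B M` lie in `ker C ∩ col M`, so
`rank (B M) ≤ dim (ker C ∩ col M) + 1`, while `rank (B M) = rank M - dim (ker B ∩ col M)`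
(`rank_mul_add_finrank_ker_inf`).  Used in Part K39-c with `|n| = 9`, `r = 7`, `rank M ≥ 4`.

References: [cite: BurgisserClausenShokrollahi1997, Prop. 15.25]; [cite: HornJohnson2013, §0.4].
-/

set_option linter.dupNamespace false

noncomputable section

namespace Summit.MatrixMultiplication.MatrixMultiplication.Theorems.OutsiderSandwichKernelDichotomy

open Literature.Computability.AlgebraicComplexity
open scoped Matrix BigOperators

/-! ## §1  Restrictions onto a unit tensor: the sandwich identity and row independence -/

section General

variable {ι κ μ ι' κ' μ' : Type*} [Fintype ι] [Fintype κ] [Fintype μ]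

/-- **Sandwich identity of a restriction**: the slices of `s = (A, B, C) · t` are
`s(a', ·, ·) = B · t(A a') · Cᵀ`. [cite: BurgisserClausenShokrollahi1997, Prop. 15.25] -/
theorem sandwich_eq {t : ι → κ → μ → ℂ} {s : ι' → κ' → μ' → ℂ} {A : ι' → ι → ℂ} {B : κ' → κ → ℂ}
    {C : μ' → μ → ℂ} (hs : ∀ a' b' c', s a' b' c' = ∑ a, ∑ b, ∑ c, A a' a * B b' b * C c' c * t a b c)
    (i : ι') : Matrix.of B * contract3 t (A i) * (Matrix.of C)ᵀ = Matrix.of (s i) := by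
  ext b' c'
  simp only [Matrix.mul_apply, Matrix.transpose_apply, Matrix.of_apply, contract3_apply, hs,
    Finset.sum_mul, Finset.mul_sum]
  rw [sum_rev₃]
  refine Finset.sum_congr rfl fun a _ => Finset.sum_congr rfl fun b _ =>
    Finset.sum_congr rfl fun c _ => ?_
  ring

/-- In a restriction `⟨r⟩ ≤ t` the first factor `A` has linearly independent rows.
[cite: BurgisserClausenShokrollahi1997, Prop. 15.25] -/
theorem linearIndependent_fst {t : ι → κ → μ → ℂ} {r : ℕ} {A : Fin r → ι → ℂ} {B : Fin r → κ → ℂ}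
    {C : Fin r → μ → ℂ}
    (hs : ∀ a' b' c', unitTensor ℂ r a' b' c' = ∑ a, ∑ b, ∑ c, A a' a * B b' b * C c' c * t a b c) :
    LinearIndependent ℂ A := by
  rw [Fintype.linearIndependent_iff]
  intro g hg i
  have hga : ∀ a, ∑ j, g j * A j a = 0 := fun a => by
    have := congr_fun hg a
    simpa [Finset.sum_apply, Pi.smul_apply, smul_eq_mul] using this
  have h1 : ∑ j, g j * unitTensor ℂ r j i i = 0 := by
    simp_rw [hs]
    simp only [Finset.mul_sum]
    rw [Finset.sum_comm]
    refine Finset.sum_eq_zero fun a _ => ?_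
    rw [Finset.sum_comm]
    refine Finset.sum_eq_zero fun b _ => ?_
    rw [Finset.sum_comm]
    refine Finset.sum_eq_zero fun c _ => ?_
    have h0 : ∑ j, g j * (A j a * B i b * C i c * t a b c) =
        (∑ j, g j * A j a) * (B i b * C i c * t a b c) := by
      rw [Finset.sum_mul]
      exact Finset.sum_congr rfl fun j _ => by ring
    rw [h0, hga a, zero_mul]
  simp only [unitTensor_apply] at h1
  rw [Finset.sum_eq_single i (fun j _ hj => by simp [hj]) (by simp)] at h1
  simpa using h1

/-- In a restriction `⟨r⟩ ≤ t` the second factor `B` has linearly independent rows.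
[cite: BurgisserClausenShokrollahi1997, Prop. 15.25] -/
theorem linearIndependent_snd {t : ι → κ → μ → ℂ} {r : ℕ} {A : Fin r → ι → ℂ} {B : Fin r → κ → ℂ}
    {C : Fin r → μ → ℂ}
    (hs : ∀ a' b' c', unitTensor ℂ r a' b' c' = ∑ a, ∑ b, ∑ c, A a' a * B b' b * C c' c * t a b c) :
    LinearIndependent ℂ B := by
  rw [Fintype.linearIndependent_iff]
  intro g hg i
  have h0 : g ᵥ* Matrix.of B = 0 := by
    funext k
    have := congr_fun hg k
    simpa [Matrix.vecMul, dotProduct, Finset.sum_apply, Pi.smul_apply, smul_eq_mul] using this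
  have h1 : g ᵥ* (Matrix.of B * contract3 t (A i) * (Matrix.of C)ᵀ) =
      g ᵥ* Matrix.of (unitTensor ℂ r i) := by
    rw [sandwich_eq hs i]
  rw [← Matrix.vecMul_vecMul, ← Matrix.vecMul_vecMul, h0, Matrix.zero_vecMul,
    Matrix.zero_vecMul] at h1
  have h2 := congr_fun h1 i
  simp only [Pi.zero_apply, Matrix.vecMul, dotProduct, Matrix.of_apply, unitTensor_apply] at h2
  rw [Finset.sum_eq_single i (fun j _ hj => by simp [Ne.symm hj]) (by simp)] at h2
  simpa using h2.symm

/-- In a restriction `⟨r⟩ ≤ t` the third factor `C` has linearly independent rows.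
[cite: BurgisserClausenShokrollahi1997, Prop. 15.25] -/
theorem linearIndependent_trd {t : ι → κ → μ → ℂ} {r : ℕ} {A : Fin r → ι → ℂ} {B : Fin r → κ → ℂ}
    {C : Fin r → μ → ℂ}
    (hs : ∀ a' b' c', unitTensor ℂ r a' b' c' = ∑ a, ∑ b, ∑ c, A a' a * B b' b * C c' c * t a b c) :
    LinearIndependent ℂ C := by
  rw [Fintype.linearIndependent_iff]
  intro g hg i
  have h0 : (Matrix.of C)ᵀ *ᵥ g = 0 := by
    rw [Matrix.mulVec_transpose]
    funext k
    have := congr_fun hg k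
    simpa [Matrix.vecMul, dotProduct, Finset.sum_apply, Pi.smul_apply, smul_eq_mul] using this
  have h1 : (Matrix.of B * contract3 t (A i) * (Matrix.of C)ᵀ) *ᵥ g =
      Matrix.of (unitTensor ℂ r i) *ᵥ g := by
    rw [sandwich_eq hs i]
  rw [← Matrix.mulVec_mulVec, h0, Matrix.mulVec_zero] at h1
  have h2 := congr_fun h1 i
  simp only [Pi.zero_apply, Matrix.mulVec, dotProduct, Matrix.of_apply, unitTensor_apply] at h2
  rw [Finset.sum_eq_single i (fun j _ hj => by simp [Ne.symm hj]) (by simp)] at h2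
  simpa using h2.symm

end General

/-- The slices of a unit tensor have rank `≤ 1`. [folklore] -/
theorem rank_of_unitTensor_le (r : ℕ) (i : Fin r) : (Matrix.of (unitTensor ℂ r i)).rank ≤ 1 := by
  rw [Matrix.rank_eq_finrank_span_row]
  have hle : Submodule.span ℂ (Set.range (Matrix.of (unitTensor ℂ r i)).row) ≤
      Submodule.span ℂ {(Pi.single i 1 : Fin r → ℂ)} := by
    rw [Submodule.span_le]
    rintro _ ⟨j, rfl⟩
    by_cases hj : j = i
    · subst hj
      refine Submodule.subset_span ?_
      rw [Set.mem_singleton_iff]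
      funext k
      by_cases hk : k = j
      · simp [Matrix.row, hk]
      · simp [Matrix.row, hk, Ne.symm hk]
    · have h0 : (Matrix.of (unitTensor ℂ r i)).row j = 0 := by
        funext k
        simp [Matrix.row, Ne.symm hj]
      rw [h0]
      exact zero_mem _
  exact (Submodule.finrank_mono hle).trans ((finrank_span_le_card _).trans (by simp))

/-! ## §2  The kernel dichotomy -/

/-- `rank (B M) + dim (ker B ∩ col M) = rank M` (rank–nullity for `B` restricted to the column space
of `M`). [cite: HornJohnson2013, §0.4] -/
theorem rank_mul_add_finrank_ker_inf {m n p : Type*} [Fintype m] [Fintype n] [Fintype p]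
    (B : Matrix m n ℂ) (M : Matrix n p ℂ) :
    (B * M).rank + Module.finrank ℂ ↥(LinearMap.ker B.mulVecLin ⊓ LinearMap.range M.mulVecLin) =
      M.rank := by
  have h := LinearMap.finrank_range_add_finrank_ker
    (B.mulVecLin ∘ₗ (LinearMap.range M.mulVecLin).subtype)
  rw [LinearMap.range_comp, Submodule.range_subtype, LinearMap.ker_comp,
    ← Submodule.finrank_map_subtype_eq (LinearMap.range M.mulVecLin), Submodule.map_comap_subtype,
    inf_comm] at h
  have h1 : LinearMap.range (B * M).mulVecLin =
      Submodule.map B.mulVecLin (LinearMap.range M.mulVecLin) := by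
    rw [Matrix.mulVecLin_mul, LinearMap.range_comp]
  unfold Matrix.rank
  rw [h1]
  exact h

/-- **Kernel dichotomy.**  Let `B, C` (`r` rows each, linearly independent) and a symmetric `M` on
`n` satisfy `(B M Cᵀ) j l = 0` off the entry `(i, i)`, and `rank M ≥ 2 (|n| - r)`.  Then
`ker B ⊆ col M` or `ker C ⊆ col M`.  (The rows `j ≠ i` of `B M` lie in `ker C ∩ col M`, so
`rank (B M) ≤ dim (ker C ∩ col M) + 1`, while `rank (B M) = rank M - dim (ker B ∩ col M)`.)
[cite: HornJohnson2013, §0.4] -/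
theorem ker_le_range_or {n : Type*} [Fintype n] [DecidableEq n] {r : ℕ} (B C : Fin r → n → ℂ)
    (M : Matrix n n ℂ) (hM : Mᵀ = M) (i : Fin r)
    (hE : ∀ j l, ¬ (j = i ∧ l = i) → (Matrix.of B * M * (Matrix.of C)ᵀ) j l = 0)
    (hB : LinearIndependent ℂ B) (hC : LinearIndependent ℂ C)
    (hrank : 2 * Fintype.card n ≤ M.rank + 2 * r) :
    LinearMap.ker (Matrix.of B).mulVecLin ≤ LinearMap.range M.mulVecLin ∨
      LinearMap.ker (Matrix.of C).mulVecLin ≤ LinearMap.range M.mulVecLin := by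
  by_contra h
  push Not at h
  obtain ⟨hB', hC'⟩ := h
  have hsym : ∀ k l, M l k = M k l := fun k l => by rw [← Matrix.transpose_apply M k l, hM]
  -- the kernels have dimension `|n| - r`
  have hkerB : Module.finrank ℂ (LinearMap.ker (Matrix.of B).mulVecLin) + r = Fintype.card n := by
    have h := LinearMap.finrank_range_add_finrank_ker (Matrix.of B).mulVecLin
    rw [Module.finrank_fintype_fun_eq_card] at h
    have hr : Module.finrank ℂ (LinearMap.range (Matrix.of B).mulVecLin) = r := by
      change (Matrix.of B).rank = r
      rw [Matrix.rank_eq_finrank_span_row, show (Matrix.of B).row = B from rfl,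
        finrank_span_eq_card hB, Fintype.card_fin]
    omega
  have hkerC : Module.finrank ℂ (LinearMap.ker (Matrix.of C).mulVecLin) + r = Fintype.card n := by
    have h := LinearMap.finrank_range_add_finrank_ker (Matrix.of C).mulVecLin
    rw [Module.finrank_fintype_fun_eq_card] at h
    have hr : Module.finrank ℂ (LinearMap.range (Matrix.of C).mulVecLin) = r := by
      change (Matrix.of C).rank = r
      rw [Matrix.rank_eq_finrank_span_row, show (Matrix.of C).row = C from rfl,
        finrank_span_eq_card hC, Fintype.card_fin]
    omega
  -- both intersections with `col M` are proper
  have hltB : Module.finrank ℂ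
      ↥(LinearMap.ker (Matrix.of B).mulVecLin ⊓ LinearMap.range M.mulVecLin) + 1 ≤
      Module.finrank ℂ (LinearMap.ker (Matrix.of B).mulVecLin) := by
    have hlt : LinearMap.ker (Matrix.of B).mulVecLin ⊓ LinearMap.range M.mulVecLin <
        LinearMap.ker (Matrix.of B).mulVecLin :=
      lt_of_le_of_ne inf_le_left fun h => hB' (h ▸ inf_le_right)
    exact Submodule.finrank_lt_finrank_of_lt hlt
  have hltC : Module.finrank ℂ
      ↥(LinearMap.ker (Matrix.of C).mulVecLin ⊓ LinearMap.range M.mulVecLin) + 1 ≤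
      Module.finrank ℂ (LinearMap.ker (Matrix.of C).mulVecLin) := by
    have hlt : LinearMap.ker (Matrix.of C).mulVecLin ⊓ LinearMap.range M.mulVecLin <
        LinearMap.ker (Matrix.of C).mulVecLin :=
      lt_of_le_of_ne inf_le_left fun h => hC' (h ▸ inf_le_right)
    exact Submodule.finrank_lt_finrank_of_lt hlt
  -- rank–nullity for `B` on `col M`
  have h1 := rank_mul_add_finrank_ker_inf (Matrix.of B) M
  -- the rows `j ≠ i` of `B M` lie in `ker C ∩ col M`
  have hrow : ∀ j, (Matrix.of B * M) j = M *ᵥ B j := by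
    intro j
    funext k
    simp only [Matrix.mul_apply, Matrix.of_apply, Matrix.mulVec, dotProduct]
    exact Finset.sum_congr rfl fun l _ => by rw [hsym k l, mul_comm]
  have hmem : ∀ j, j ≠ i → (Matrix.of B * M) j ∈
      LinearMap.ker (Matrix.of C).mulVecLin ⊓ LinearMap.range M.mulVecLin := by
    intro j hj
    refine Submodule.mem_inf.mpr ⟨?_, ?_⟩
    · rw [LinearMap.mem_ker, Matrix.mulVecLin_apply]
      funext l
      have h0 := hE j l (fun h => hj h.1)
      simp only [Matrix.mul_apply, Matrix.transpose_apply, Matrix.of_apply] at h0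
      simp only [Matrix.mulVec, dotProduct, Matrix.of_apply, Pi.zero_apply, Matrix.mul_apply]
      rw [← h0]
      exact Finset.sum_congr rfl fun k _ => mul_comm _ _
    · rw [hrow j]
      exact LinearMap.mem_range.mpr ⟨B j, rfl⟩
  have hup : (Matrix.of B * M).rank ≤
      Module.finrank ℂ ↥(LinearMap.ker (Matrix.of C).mulVecLin ⊓ LinearMap.range M.mulVecLin) + 1 := by
    rw [Matrix.rank_eq_finrank_span_row]
    have hle : Submodule.span ℂ (Set.range (Matrix.of B * M).row) ≤
        (LinearMap.ker (Matrix.of C).mulVecLin ⊓ LinearMap.range M.mulVecLin) ⊔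
          Submodule.span ℂ {(Matrix.of B * M) i} := by
      rw [Submodule.span_le]
      rintro _ ⟨j, rfl⟩
      by_cases hj : j = i
      · rw [hj]
        exact Submodule.mem_sup_right (Submodule.subset_span rfl)
      · exact Submodule.mem_sup_left (hmem j hj)
    calc _ ≤ Module.finrank ℂ ↥((LinearMap.ker (Matrix.of C).mulVecLin ⊓ LinearMap.range M.mulVecLin) ⊔
          Submodule.span ℂ {(Matrix.of B * M) i}) := Submodule.finrank_mono hle
      _ ≤ Module.finrank ℂ ↥(LinearMap.ker (Matrix.of C).mulVecLin ⊓ LinearMap.range M.mulVecLin) +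
          Module.finrank ℂ ↥(Submodule.span ℂ {(Matrix.of B * M) i}) :=
          Submodule.finrank_add_le_finrank_add_finrank _ _
      _ ≤ _ := by
          gcongr
          exact (finrank_span_le_card _).trans (by simp)
  omega

end Summit.MatrixMultiplication.MatrixMultiplication.Theorems.OutsiderSandwichKernelDichotomy
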